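import Summits.Ventures.HSemireg.WedgeHankelRecurrenceGaussChebyshevVWRootsReal

/-!
# Venture HSemireg — **THE REAL ROOT MULTISETS OF THE CHEBYSHEV LEVEL SETS `T_n = ±1` (WITH MULTIPLICITIES): `(T_{2k+1} − 1).roots = {1} + 2·{cos(2jπ∕(2k+1)) : 1 ≤ j ≤ k}`,
# `(T_{2k+1} + 1).roots = {−1} + 2·{cos((2j+1)π∕(2k+1)) : j < k}`, `(T_{2k+2} − 1).roots = {1, −1} + 2·{cos(jπ∕(k+1)) : 1 ≤ j ≤ k}`, `(T_{2k} + 1).roots = 2·{cos((2j+1)π∕2k) : j < k}`** —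
# the interior alternation points `cos(jπ∕n)`, `0 < j < n`, are DOUBLE roots of `T_n ∓ 1`, the endpoints `±1` simple; `T_n ∓ 1` split over `ℝ` (`card roots = n`)

HONEST FRAMING. Part of the Lean index of the computation cell `pub-hsemireg` (seat p10 gen 49, Sunday typer «UNIFORM-IN-n»).  Real polynomial algebra and trigonometry only (Mathlib
`Polynomial.Chebyshev.T ∕ U`, `Polynomial.roots`, `Real.cos`); no variety, no cohomology theory, no sheaf, no Ext group and no semiregularity map is constructed here; nothing here says that
HC / HC_CM / HC_AV holds; no Literature fact (unproved `Prop`) is declared or used.  Custodian versions as in `WedgeHankelSiegelIdeal` (1/3).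
SOURCES (cited).  T. J. Rivlin, *The Chebyshev Polynomials* (1974), §1.2 (the extremal points `η_j = cos(jπ∕n)` of `T_n`) and §2.7 (the Pell identity `T_n² − 1 = (x² − 1)U_{n−1}²`); J. C. Mason,
D. C. Handscomb, *Chebyshev Polynomials* (2003), (1.18)–(1.20), §2.2; A. Erdélyi et al., *Higher Transcendental Functions* II (1953), §10.11.
PROOF TYPED HERE.  Rewrite with the half-angle identities of N478 (`T_{2k+1} − 1 = (X − 1)W_k²`, `T_{2k+1} + 1 = (X + 1)V_k²`, `T_{2k} − 1 = 2(X² − 1)U_{k−1}²`, `T_{2k} + 1 = 2T_k²`), then Mathlib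
`roots_mul ∕ roots_pow ∕ roots_C_mul ∕ roots_X_sub_C`, the simple-root multisets of N503 (`V_k`, `W_k`) and Mathlib `roots_T_real`, `roots_U_real` (restated in `Multiset.map` form).
DEDUP DISCLOSURE (`rg -n 'sub_one_roots|add_one_roots|T_roots_real_map' Summits/Ventures/HSemireg`, `lean search`, 2026-09-04): Mathlib has the root SETS `eval_T_real_eq_one_iff ∕
_eq_neg_one_iff` and `isLocalExtr_T_real_iff` (no multiplicities); N478 has the `x = 1 ∨ W_k(x) = 0` readings; the multisets below are not in the tree; 0 hits for the 8 names below.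

WHAT IS IN THE TREE.  N478 (identities), N503 `chebyshevU_add_pred_roots_real ∕ chebyshevU_sub_pred_roots_real`, Mathlib `roots_T_real(_nodup)`, `roots_U_real(_nodup)`.
THIS FILE (namespace `Summit.Ventures.HSemireg.Wedge.HankelOuter` continued; CHAINED on N503; 0 definitions):
* §1269 `chebyshevT_roots_real_map`, `chebyshevU_roots_real_map` (Mathlib's root multisets as `Multiset.map` over `range`), **`chebyshevT_odd_sub_one_roots_real`**,
  **`chebyshevT_odd_add_one_roots_real`**, **`chebyshevT_even_sub_one_roots_real`**, **`chebyshevT_even_add_one_roots_real`**, `chebyshevT_sub_one_roots_card_real`, `chebyshevT_add_one_roots_card_real`.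
CAVEATS.  Indices `2k+1`, `2k+2` (resp. `2k`) with `k ∈ ℕ`; `T_0 − 1 = 0` is excluded by the indexing.  Nothing Ext-side.  New names only.
-/

open Module Polynomial Real
open scoped Matrix Polynomial

namespace Summit.Ventures.HSemireg.Wedge.HankelOuter

/-! ## §1269. Real root multisets of `T_n ∓ 1` -/

/-- Mathlib's `roots_T_real` in `Multiset.map` form: `(T ℝ n).roots = {cos((2k+1)π∕2n) : k < n}`. [Rivlin §1.2; this file, §1269] -/
theorem chebyshevT_roots_real_map (n : ℕ) :
    (Polynomial.Chebyshev.T ℝ (n : ℤ)).roots = (Multiset.range n).map fun k : ℕ => cos ((2 * k + 1) * π / (2 * n)) := by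
  classical
  rw [Polynomial.Chebyshev.roots_T_real, Finset.image_val_of_injOn ((Finset.range n).nodup_map_iff_injOn.mp (Polynomial.Chebyshev.roots_T_real_nodup n)), Finset.range_val]

/-- Mathlib's `roots_U_real` in `Multiset.map` form: `(U ℝ n).roots = {cos((k+1)π∕(n+1)) : k < n}`. [Rivlin §1.2; this file, §1269] -/
theorem chebyshevU_roots_real_map (n : ℕ) :
    (Polynomial.Chebyshev.U ℝ (n : ℤ)).roots = (Multiset.range n).map fun k : ℕ => cos ((k + 1) * π / (n + 1)) := by
  classical
  rw [Polynomial.Chebyshev.roots_U_real, Finset.image_val_of_injOn ((Finset.range n).nodup_map_iff_injOn.mp (Polynomial.Chebyshev.roots_U_real_nodup n)), Finset.range_val]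

/-- **`(T_{2k+1} − 1).roots = {1} + 2·{cos(2(j+1)π∕(2k+1)) : j < k}` over `ℝ`** (interior points double, `1` simple). [Rivlin §1.2; Mason–Handscomb §2.2; this file, §1269] -/
theorem chebyshevT_odd_sub_one_roots_real (k : ℕ) :
    (Polynomial.Chebyshev.T ℝ (2 * (k : ℤ) + 1) - 1).roots = {1} + 2 • (Multiset.range k).map fun j : ℕ => cos (2 * (j + 1) * π / (2 * k + 1)) := by
  have hW : Polynomial.Chebyshev.U ℝ (k : ℤ) + Polynomial.Chebyshev.U ℝ ((k : ℤ) - 1) ≠ 0 := by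
    rw [← degree_ne_bot, (chebyshevU_add_pred_degree_leadingCoeff (R := ℝ) k).1]; exact WithBot.natCast_ne_bot k
  have hX1 : (Polynomial.X - 1 : ℝ[X]) = Polynomial.X - Polynomial.C 1 := by rw [map_one]
  have hne : (Polynomial.X - 1 : ℝ[X]) * (Polynomial.Chebyshev.U ℝ (k : ℤ) + Polynomial.Chebyshev.U ℝ ((k : ℤ) - 1)) ^ 2 ≠ 0 := by
    rw [hX1]; exact mul_ne_zero (X_sub_C_ne_zero 1) (pow_ne_zero 2 hW)
  rw [chebyshevT_two_mul_add_one_sub_one, roots_mul hne, hX1, roots_X_sub_C, roots_pow, chebyshevU_add_pred_roots_real]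

/-- **`(T_{2k+1} + 1).roots = {−1} + 2·{cos((2j+1)π∕(2k+1)) : j < k}` over `ℝ`** (interior points double, `−1` simple). [Rivlin §1.2; Mason–Handscomb §2.2; this file, §1269] -/
theorem chebyshevT_odd_add_one_roots_real (k : ℕ) :
    (Polynomial.Chebyshev.T ℝ (2 * (k : ℤ) + 1) + 1).roots = {-1} + 2 • (Multiset.range k).map fun j : ℕ => cos ((2 * j + 1) * π / (2 * k + 1)) := by
  have hV : Polynomial.Chebyshev.U ℝ (k : ℤ) - Polynomial.Chebyshev.U ℝ ((k : ℤ) - 1) ≠ 0 := by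
    rw [← degree_ne_bot, (chebyshevU_sub_pred_degree_leadingCoeff (R := ℝ) k).1]; exact WithBot.natCast_ne_bot k
  have hX1 : (Polynomial.X + 1 : ℝ[X]) = Polynomial.X - Polynomial.C (-1) := by rw [map_neg, map_one, sub_neg_eq_add]
  have hne : (Polynomial.X + 1 : ℝ[X]) * (Polynomial.Chebyshev.U ℝ (k : ℤ) - Polynomial.Chebyshev.U ℝ ((k : ℤ) - 1)) ^ 2 ≠ 0 := by
    rw [hX1]; exact mul_ne_zero (X_sub_C_ne_zero (-1)) (pow_ne_zero 2 hV)
  rw [chebyshevT_two_mul_add_one_add_one, roots_mul hne, hX1, roots_X_sub_C, roots_pow, chebyshevU_sub_pred_roots_real]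

/-- **`(T_{2k+2} − 1).roots = {1, −1} + 2·{cos((j+1)π∕(k+1)) : j < k}` over `ℝ`** (interior points double, `±1` simple). [Rivlin §1.2, §2.7; this file, §1269] -/
theorem chebyshevT_even_sub_one_roots_real (k : ℕ) :
    (Polynomial.Chebyshev.T ℝ (2 * ((k : ℤ) + 1)) - 1).roots = {1, -1} + 2 • (Multiset.range k).map fun j : ℕ => cos ((j + 1) * π / (k + 1)) := by
  have hU : Polynomial.Chebyshev.U ℝ (k : ℤ) ≠ 0 := by
    rw [← degree_ne_bot, Polynomial.Chebyshev.degree_U_natCast]; exact WithBot.natCast_ne_bot k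
  have h2 : (2 * (Polynomial.X ^ 2 - 1) : ℝ[X]) = Polynomial.C 2 * ((Polynomial.X - Polynomial.C 1) * (Polynomial.X - Polynomial.C (-1))) := by
    rw [map_neg, map_one, ← Polynomial.C_ofNat]; ring
  have hne1 : (Polynomial.X - Polynomial.C 1 : ℝ[X]) * (Polynomial.X - Polynomial.C (-1)) ≠ 0 := mul_ne_zero (X_sub_C_ne_zero 1) (X_sub_C_ne_zero (-1))
  have hne : (2 * (Polynomial.X ^ 2 - 1) : ℝ[X]) * Polynomial.Chebyshev.U ℝ (k : ℤ) ^ 2 ≠ 0 := by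
    rw [h2]; exact mul_ne_zero (mul_ne_zero (Polynomial.C_ne_zero.mpr two_ne_zero) hne1) (pow_ne_zero 2 hU)
  rw [chebyshevT_two_mul_sub_one_eq, add_sub_cancel_right, roots_mul hne, h2, roots_C_mul _ two_ne_zero, roots_mul hne1, roots_X_sub_C, roots_X_sub_C, roots_pow,
    chebyshevU_roots_real_map, Multiset.singleton_add, ← Multiset.insert_eq_cons]

/-- **`(T_{2k} + 1).roots = 2·{cos((2j+1)π∕2k) : j < k}` over `ℝ`** (every root double; `T_{2k} + 1 = 2T_k²`). [Rivlin §1.2; this file, §1269] -/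
theorem chebyshevT_even_add_one_roots_real (k : ℕ) :
    (Polynomial.Chebyshev.T ℝ (2 * (k : ℤ)) + 1).roots = 2 • (Multiset.range k).map fun j : ℕ => cos ((2 * j + 1) * π / (2 * k)) := by
  rw [chebyshevT_two_mul_add_one_eq_two_mul_sq, ← Polynomial.C_ofNat, roots_C_mul _ two_ne_zero, roots_pow, chebyshevT_roots_real_map]

/-- **`T_n − 1` splits over `ℝ`: `card (T_n − 1).roots = n`** (`n ≥ 1`; the roots are `cos(2jπ∕n)`, `0 ≤ j < n`, listed with multiplicity). [Rivlin §1.2; this file, §1269] -/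
theorem chebyshevT_sub_one_roots_card_real {n : ℕ} (hn : n ≠ 0) : Multiset.card (Polynomial.Chebyshev.T ℝ (n : ℤ) - 1).roots = n := by
  obtain ⟨k, rfl | rfl⟩ := Nat.even_or_odd' n
  · obtain ⟨j, rfl⟩ := Nat.exists_eq_add_one_of_ne_zero (by rintro rfl; exact hn rfl : k ≠ 0)
    rw [show (((2 * (j + 1) : ℕ)) : ℤ) = 2 * ((j : ℤ) + 1) by push_cast; ring, chebyshevT_even_sub_one_roots_real, Multiset.card_add, Multiset.card_nsmul, Multiset.card_map,
      Multiset.card_range, Multiset.insert_eq_cons, Multiset.card_cons, Multiset.card_singleton]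
    ring
  · rw [show (((2 * k + 1 : ℕ)) : ℤ) = 2 * (k : ℤ) + 1 by push_cast; ring, chebyshevT_odd_sub_one_roots_real, Multiset.card_add, Multiset.card_nsmul, Multiset.card_map, Multiset.card_range,
      Multiset.card_singleton]
    ring

/-- **`T_n + 1` splits over `ℝ`: `card (T_n + 1).roots = n`** (the roots are `cos((2j+1)π∕n)`, `0 ≤ j < n`, listed with multiplicity; `n = 0`: `T_0 + 1 = 2`, no roots). [Rivlin §1.2; this file, §1269] -/
theorem chebyshevT_add_one_roots_card_real (n : ℕ) : Multiset.card (Polynomial.Chebyshev.T ℝ (n : ℤ) + 1).roots = n := by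
  obtain ⟨k, rfl | rfl⟩ := Nat.even_or_odd' n
  · rw [show (((2 * k : ℕ)) : ℤ) = 2 * (k : ℤ) by push_cast; ring, chebyshevT_even_add_one_roots_real, Multiset.card_nsmul, Multiset.card_map, Multiset.card_range]
  · rw [show (((2 * k + 1 : ℕ)) : ℤ) = 2 * (k : ℤ) + 1 by push_cast; ring, chebyshevT_odd_add_one_roots_real, Multiset.card_add, Multiset.card_nsmul, Multiset.card_map, Multiset.card_range,
      Multiset.card_singleton]
    ring

end Summit.Ventures.HSemireg.Wedge.HankelOuter
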